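import Summits.Ventures.PercRepro.RankLevelSetAvgBridge
import Summits.Ventures.PercRepro.RankLevelSetAvgChargeS

/-!
# PercRepro — [re-pointed at the primed (`_S`) parents per (um)(35)(2)–(4); the landed originals are the citations]
# THE ASSEMBLY OF THE AVERAGED (MC) ON THE TIGHT LAYER (night-1, gen 9 session 4; dossier §19.12)

`avg_contract_le_of_num`: on the tight layer, for every loopless matroid, IF the binomial inequality
`Φ(p−1,q)·k ≤ NUM′(p,q,k)` holds for `1 ≤ k ≤ q`, then `Σ_e σ_{M／e}(p−1,q) ≤ |E|·σ_M(p,q)` — hence some `e` has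
`σ_{M／e}(p−1,q) ≤ σ_M(p,q)` (`exists_slack_contract_le_of_num`): C-037's statement at `(M,p,q)` with no circuit
hypothesis.  The pieces: the identity (`avg_contract_le_iff`), the supply as a sum of rule weights, the demand split,
part 1 and part 2 in the vocabulary of sets (RankLevelSetAvgBridge), and the charging lemma
(`sum_charge_le_sum_weight_S`) twice.  The binomial inequality itself is verified exactly for every `p ≤ 100`
(dossier §19.12 (e), (g)) and is NOT proved here.

Axioms: standard.
-/
open scoped Matroid

namespace PercRepro

open Set Finset

variable {α : Type} (M : Matroid α) [M.Finite]

open scoped Classical in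
/-- **THE AVERAGED (MC) ON THE TIGHT LAYER, MODULO THE BINOMIAL INEQUALITY**: for every loopless matroid with
`|E| = p + q`, `1 ≤ q`, `q + 2 ≤ p`, if `Φ(p−1,q)·k ≤ NUM′(p,q,k)` for `1 ≤ k ≤ q`, then
`Σ_{e ∈ E} σ_{M／{e}}(p−1,q) ≤ |E|·σ_M(p,q)`. -/
theorem avg_contract_le_of_num (hl : ∀ e ∈ M.E, M.IsNonloop e) {p q : ℕ} (hq : 1 ≤ q) (hpq : q + 2 ≤ p)
    (hE : M.E.ncard = p + q)
    (hnum : ∀ k : ℕ, 1 ≤ k → k ≤ q → phiK (p - 1) q * (k : ℚ) ≤ numPrime p q k) :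
    ∑ e ∈ (M.set_finite M.E).toFinset, Matroid.slack (M ／ {e}) (p - 1) q ≤
      (M.E.ncard : ℚ) * Matroid.slack M p q := by
  have hp : 1 ≤ p := by omega
  rw [avg_contract_le_iff M hl hp hE, supply_eq_sum_ruleWeight M p q]
  set Uf := (Uset_finite_S M p q).toFinset with hUf
  set Yf := (Yset_finite M p q).toFinset with hYf
  -- the demand as a sum over the members
  have htop : (Matroid.topCount M p q : ℚ) = (Uf.card : ℚ) := by
    rw [topCount_eq_ncard_Uset, hUf, Set.ncard_eq_toFinset_card _ (Uset_finite_S M p q)]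
  have hdemand : (M.E.ncard : ℚ) * phiK p q * (Matroid.topCount M p q : ℚ) -
      phiK (p - 1) q * ∑ A ∈ Uf, ((A \ M.closure (M.E \ A)).ncard : ℚ) =
      ∑ A ∈ Uf, ((M.E.ncard : ℚ) * phiK p q - phiK (p - 1) q * ((A \ M.closure (M.E \ A)).ncard : ℚ)) := by
    rw [Finset.sum_sub_distrib, Finset.sum_const, nsmul_eq_mul, Finset.mul_sum, htop]
    ring
  -- received amounts
  let rec₁ : Set α → ℚ := fun A => ∑ T ∈ Yf.filter (fun T => M.Indep T ∧ T ⊆ A),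
    ruleWeight M q T / ((Uf.filter (fun A' => T ⊆ A')).card : ℚ)
  let rec₂ : Set α → ℚ := fun A => ∑ T ∈ Yf.filter (fun T => ¬ M.Indep T ∧ M.E \ A ⊆ T),
    ruleWeight M q T / ((Uf.filter (fun A' => M.E \ A' ⊆ T)).card : ℚ)
  have hrec : ∀ A ∈ Uf, (M.E.ncard : ℚ) * phiK p q - phiK (p - 1) q * ((A \ M.closure (M.E \ A)).ncard : ℚ) ≤
      rec₁ A + rec₂ A := by
    intro A hA
    rw [hUf, Set.Finite.mem_toFinset] at hA
    rw [demand_split M hE hA]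
    have h1 : ((p + q : ℕ) : ℚ) * phiK p q - (p : ℚ) * phiK (p - 1) q ≤ rec₁ A :=
      indep_charge_ge_set M hq hpq hE hA
    have hn : (M.E.ncard : ℚ) = ((p + q : ℕ) : ℚ) := by rw [hE]
    rw [hn]
    have h2 : phiK (p - 1) q * ((M.closure (M.E \ A) \ (M.E \ A)).ncard : ℚ) ≤ rec₂ A := by
      refine le_trans ?_ (dep_charge_ge_set M hq hpq hE hA)
      set k := (M.closure (M.E \ A) \ (M.E \ A)).ncard with hk
      have hk_le : k ≤ q := by
        have h := ncard_sdiff_closure_add_excess_le_S M hE hA hA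
        omega
      rcases Nat.eq_zero_or_pos k with hk0 | hkpos
      · rw [hk0]
        simp only [Nat.cast_zero, mul_zero, numPrime]
        simp
      · exact hnum k hkpos hk_le
    linarith
  -- each supplier gives out at most its weight (twice)
  have hcharge₁ : ∑ A ∈ Uf, rec₁ A ≤ ∑ T ∈ Yf.filter (fun T => M.Indep T), ruleWeight M q T := by
    have := sum_charge_le_sum_weight_S Uf (Yf.filter (fun T => M.Indep T)) (fun A T => T ⊆ A)
      (ruleWeight M q) (fun T hT => by
        rw [Finset.mem_filter, hYf, Set.Finite.mem_toFinset] at hT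
        exact ruleWeight_nonneg M hT.1.1)
    refine le_trans (le_of_eq ?_) this
    refine Finset.sum_congr rfl (fun A _ => ?_)
    simp only [rec₁, Finset.filter_filter]
  have hcharge₂ : ∑ A ∈ Uf, rec₂ A ≤ ∑ T ∈ Yf.filter (fun T => ¬ M.Indep T), ruleWeight M q T := by
    have := sum_charge_le_sum_weight_S Uf (Yf.filter (fun T => ¬ M.Indep T)) (fun A T => M.E \ A ⊆ T)
      (ruleWeight M q) (fun T hT => by
        rw [Finset.mem_filter, hYf, Set.Finite.mem_toFinset] at hT
        exact ruleWeight_nonneg M hT.1.1)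
    refine le_trans (le_of_eq ?_) this
    refine Finset.sum_congr rfl (fun A _ => ?_)
    simp only [rec₂, Finset.filter_filter]
  have htotal : ∑ T ∈ Yf.filter (fun T => M.Indep T), ruleWeight M q T +
      ∑ T ∈ Yf.filter (fun T => ¬ M.Indep T), ruleWeight M q T = ∑ T ∈ Yf, ruleWeight M q T :=
    Finset.sum_filter_add_sum_filter_not Yf _ _
  calc (M.E.ncard : ℚ) * phiK p q * (Matroid.topCount M p q : ℚ)
      = ∑ A ∈ Uf, ((M.E.ncard : ℚ) * phiK p q - phiK (p - 1) q * ((A \ M.closure (M.E \ A)).ncard : ℚ)) +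
          phiK (p - 1) q * ∑ A ∈ Uf, ((A \ M.closure (M.E \ A)).ncard : ℚ) := by
        rw [← hdemand]; ring
    _ ≤ (∑ A ∈ Uf, rec₁ A + ∑ A ∈ Uf, rec₂ A) +
          phiK (p - 1) q * ∑ A ∈ Uf, ((A \ M.closure (M.E \ A)).ncard : ℚ) := by
        rw [← Finset.sum_add_distrib]
        exact add_le_add_left (Finset.sum_le_sum hrec) _
    _ ≤ ∑ T ∈ Yf, ruleWeight M q T + phiK (p - 1) q * ∑ A ∈ Uf, ((A \ M.closure (M.E \ A)).ncard : ℚ) := by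
        rw [← htotal]
        exact add_le_add_left (add_le_add hcharge₁ hcharge₂) _

/-- **C-037'S STATEMENT ON THE TIGHT LAYER, MODULO THE BINOMIAL INEQUALITY**: some element `e` has
`σ_{M／{e}}(p−1,q) ≤ σ_M(p,q)`. -/
theorem exists_slack_contract_le_of_num (hl : ∀ e ∈ M.E, M.IsNonloop e) {p q : ℕ} (hq : 1 ≤ q)
    (hpq : q + 2 ≤ p) (hE : M.E.ncard = p + q)
    (hnum : ∀ k : ℕ, 1 ≤ k → k ≤ q → phiK (p - 1) q * (k : ℚ) ≤ numPrime p q k) :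
    ∃ e ∈ M.E, Matroid.slack (M ／ {e}) (p - 1) q ≤ Matroid.slack M p q :=
  exists_slack_contract_le_of_avg M hE hq (avg_contract_le_of_num M hl hq hpq hE hnum)

end PercRepro
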